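import Summits.HodgeConjecture.CorCM.IrreducibleOddWeightsIsotypicExistenceCriteria
import HarnessLib

/-!
# Isotypic cells, existence VII: THE CLASS BLOCKS AND THE CLASS MULTIPLICITIES ARE INTRINSIC —
# `(⨆_s S(W_s)) ∩ 𝒞_c = ⨆_s S(p^s_c)`, `r_c·dim A_c = dim((⨆_i MC_i) ∩ 𝒞_c)`, and isomorphic references have the
# same container `𝒞`

COR-CM (cell `pub-hodgecm2`, binder seat `b16` gen 76, count-neutral claim THE ISOTYPIC DECOMPOSITION EXISTS, file
E7 — `ℚ^G` level, type ranks and the CM dress; theorems only, no definition, no named fact, no `sorry`).  NEW as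
stated, hence under `Summits/`.  HONEST FRAMING: in gen 75's multiplicity formula `dim Hg(∏_i A_i) = Σ_c r_c·dim A_c`
(M4/M5) the integers `r_c` are produced from a CHOSEN isotypic decomposition of the type vectors (the `𝒟_c`-rank of
the class-`c` components).  File E3 showed a decomposition always exists; this file shows the numbers do not depend
on the choice: the class block `B_c = ⨆_s S(p^s_c)` is the intersection of the whole coefficient space with the
CONTAINER `𝒞_c = Σ_{y} Θ_y(A_c) ≤ ℚ^G` of the reference, and the container depends only on the isomorphism class
of `A_c`.  Nothing about Hodge classes is asserted; `HC_CM` is neither used nor asserted.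

SETTING (gen 75 M2): references `A_c ≤ ℚ^{Y_c}` stable irreducible pairwise non-embeddable; slots `s ∈ S` with
pivots `Y_s`, equivariant jointly independent embeddings `ι^s_{c,j}`, components `b^s_{c,j} ∈ A_c`, class parts
`p^s_c = Σ_j ι^s_{c,j}(b^s_{c,j})`, slot vectors `W_s = Σ_c p^s_c`, `S(w) = span{g ↦ w(g·y)} ≤ ℚ^G`, container
`𝒞_c = ⨆_{y ∈ Y_c} Θ_y(A_c)` (`Θ_y(a) = (g ↦ a(g·y))`).

* §1 **CONTAINERS OF ISOMORPHIC REFERENCES COINCIDE** (`container_le_of_onto`, `container_eq_of_iso`,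
  `container_eq_of_embed_of_irreducible`): an equivariant `θ` with `θ(A) ⊇ B` gives `𝒞_B ≤ 𝒞_A`; an equivariant
  embedding of a non-zero stable `A` into an irreducible `B` gives `𝒞_A = 𝒞_B`.
* §2 **THE CLASS BLOCK IS INTRINSIC** (`iSup_span_shadowCoeff_inf_container_eq`): **`(⨆_s S(W_s)) ⊓ 𝒞_c =
  ⨆_s S(p^s_c)`** (M2: the blocks lie in their containers, the containers are independent, `⨆_s S(W_s) = ⨆_c B_c`);
  hence (`exists_rank_finrank_iSup_span_shadowCoeff_inf_container_eq`) **`dim((⨆_s S(W_s)) ⊓ 𝒞_c) = r_c·dim A_c`**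
  with `dim ⨆_{s,j} 𝒟_c·b^s_{c,j} = r_c·δ_c`, `r_c ≤ Σ_s |J_{s,c}|`, and `dim ⨆_s S(W_s) = Σ_c r_c·dim A_c`.
* §3 TYPE RANKS (`exists_rank_finrank_iSup_span_coeff_inf_container_eq`): for a family of CM types with an isotypic
  decomposition of the type vectors, **`dim((⨆_i MC_i) ⊓ 𝒞_c) = r_c·dim A_c`** and `rank Σ = Σ_c r_c·dim A_c + 1`
  (`MC_i = span{g ↦ u_i(g·x)}` the character space of `MT(A_i)`): THE CLASS MULTIPLICITY `r_c` OF THE HODGE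
  CHARACTER MODULE IS `dim((⨆_i MC_i) ∩ 𝒞_c)/dim A_c`, independent of the decomposition; with NO input but the
  types (`exists_isotypic_finrank_inf_container_eq`) and the CM dress (`exists_isotypic_cm_finrank_inf_container_eq`).

## References

* [Serre1977] J.-P. Serre, *Linear Representations of Finite Groups*, GTM 42, §2.6 (canonical decomposition: the
  isotypic components are intrinsic), §2.7.
* [Deligne1982HodgeCycles] P. Deligne, *Hodge cycles on abelian varieties*, LNM 900 (1982), I.3.4, I.5 (p. 53).
* [Lang2002] S. Lang, *Algebra*, 3rd ed., XVII §2–§3.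
* [CurtisReiner1962] C. W. Curtis, I. Reiner, *Representation Theory of Finite Groups and Associative Algebras*, §27.
-/

set_option autoImplicit false

noncomputable section

open scoped BigOperators Classical

universe u uC uJ uS v v' vA vB vC w

namespace Summit.HodgeConjecture.CorCM.IrrOdd

open Literature.NumberTheory.ComplexMultiplication

variable {G : Type w} [Group G]

/-! ### §1 Containers of isomorphic references coincide -/

section Containers

variable {YA : Type vA} [MulAction G YA] [Fintype YA] {YB : Type vB} [MulAction G YB] [Fintype YB]

omit [Fintype YB] in
/-- **`θ(A) ⊇ B` ⟹ `𝒞_B ≤ 𝒞_A`**: if `θ : ℚ^{Y_A} → ℚ^{Y_B}` is equivariant on `A` and every element of `B` is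
`θ a` for some `a ∈ A`, then every cell `Θ_y(B)` lies in the container `Σ_{y′} Θ_{y′}(A)` (`(g ↦ θa(g·y)) ∈ S(θ a) ≤
𝒞_A`, gen 75 M2). [cite: Serre1977, §2.6] -/
theorem container_le_of_onto {A : Submodule ℚ (YA → ℚ)} {B : Submodule ℚ (YB → ℚ)}
    (θ : (YA → ℚ) →ₗ[ℚ] (YB → ℚ))
    (hθeq : ∀ (k : G) (a : YA → ℚ), a ∈ A → θ (fun y => a (k • y)) = fun z => θ a (k • z))
    (hsurj : ∀ b ∈ B, ∃ a ∈ A, θ a = b) :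
    (⨆ y : YB, B.map (LinearMap.funLeft ℚ ℚ (fun g : G => g • y))) ≤
      ⨆ y : YA, A.map (LinearMap.funLeft ℚ ℚ (fun g : G => g • y)) := by
  refine iSup_le fun y => Submodule.map_le_iff_le_comap.2 fun b hb => ?_
  obtain ⟨a, ha, rfl⟩ := hsurj b hb
  exact span_shadowCoeff_le_container_of_map θ hθeq ha (Submodule.subset_span ⟨y, rfl⟩)

/-- **ISOMORPHIC REFERENCES HAVE THE SAME CONTAINER**: equivariant `θ : A ↠ B` and `θ′ : B ↠ A` give
`𝒞_A = 𝒞_B`. [cite: Serre1977, §2.6] -/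
theorem container_eq_of_iso {A : Submodule ℚ (YA → ℚ)} {B : Submodule ℚ (YB → ℚ)}
    (θ : (YA → ℚ) →ₗ[ℚ] (YB → ℚ))
    (hθeq : ∀ (k : G) (a : YA → ℚ), a ∈ A → θ (fun y => a (k • y)) = fun z => θ a (k • z))
    (hsurj : ∀ b ∈ B, ∃ a ∈ A, θ a = b)
    (θ' : (YB → ℚ) →ₗ[ℚ] (YA → ℚ))
    (hθ'eq : ∀ (k : G) (b : YB → ℚ), b ∈ B → θ' (fun y => b (k • y)) = fun z => θ' b (k • z))
    (hsurj' : ∀ a ∈ A, ∃ b ∈ B, θ' b = a) :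
    (⨆ y : YA, A.map (LinearMap.funLeft ℚ ℚ (fun g : G => g • y))) =
      ⨆ y : YB, B.map (LinearMap.funLeft ℚ ℚ (fun g : G => g • y)) :=
  le_antisymm (container_le_of_onto θ' hθ'eq hsurj') (container_le_of_onto θ hθeq hsurj)

/-- **AN EMBEDDING OF A NON-ZERO STABLE `A` INTO AN IRREDUCIBLE STABLE `B` GIVES `𝒞_A = 𝒞_B`** (the embedding is
onto by irreducibility, E6 §1; an inverse embedding `B ↪ A` exists by gen 75 M1's transport and is onto `A` when
`A` is irreducible). [cite: Serre1977, §2.2 and §2.6] -/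
theorem container_eq_of_embed_of_irreducible {A : Submodule ℚ (YA → ℚ)} {B : Submodule ℚ (YB → ℚ)}
    (hAst : ∀ (k : G) (a : YA → ℚ), a ∈ A → (fun y => a (k • y)) ∈ A) (hA0 : A ≠ ⊥)
    (hAirr : ∀ W : Submodule ℚ (YA → ℚ), W ≤ A → W ≠ ⊥ →
      (∀ (k : G) (f : YA → ℚ), f ∈ W → (fun y => f (k • y)) ∈ W) → W = A)
    (hBst : ∀ (k : G) (b : YB → ℚ), b ∈ B → (fun y => b (k • y)) ∈ B)
    (hBirr : ∀ W : Submodule ℚ (YB → ℚ), W ≤ B → W ≠ ⊥ →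
      (∀ (k : G) (f : YB → ℚ), f ∈ W → (fun y => f (k • y)) ∈ W) → W = B)
    (θ : (YA → ℚ) →ₗ[ℚ] (YB → ℚ)) (hθB : ∀ a ∈ A, θ a ∈ B) (hθinj : ∀ a ∈ A, θ a = 0 → a = 0)
    (hθeq : ∀ (k : G) (a : YA → ℚ), a ∈ A → θ (fun y => a (k • y)) = fun z => θ a (k • z)) :
    (⨆ y : YA, A.map (LinearMap.funLeft ℚ ℚ (fun g : G => g • y))) =
      ⨆ y : YB, B.map (LinearMap.funLeft ℚ ℚ (fun g : G => g • y)) := by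
  have hsurj : ∀ b ∈ B, ∃ a ∈ A, θ a = b := onto_of_embed_of_irreducible' (G := G) θ hAst hA0 hBirr hθB hθinj hθeq
  -- an inverse embedding `B ↪ A` (transport of `id : B → θ(A)`), onto `A` by irreducibility
  have hL : ∀ v ∈ B.map (LinearMap.id : (YB → ℚ) →ₗ[ℚ] (YB → ℚ)),
      (LinearMap.id : (YB → ℚ) →ₗ[ℚ] (YB → ℚ)) v ∈ A.map θ := by
    intro v hv
    rw [Submodule.map_id] at hv
    obtain ⟨a, ha, hθa⟩ := hsurj v hv
    exact Submodule.mem_map.2 ⟨a, ha, hθa⟩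
  obtain ⟨θ', hθ'A, hθ'inj, hθ'eq⟩ := exists_embed_of_map_embed (G := G) hBst hAst LinearMap.id θ
    (fun _ _ _ => rfl) hθeq (fun _ _ h => h) hθinj LinearMap.id hL (fun v _ h => h) (fun _ _ _ => rfl)
  have hB0 : B ≠ ⊥ := by
    intro hB
    obtain ⟨a, ha, ha0⟩ := Submodule.exists_mem_ne_zero_of_ne_bot hA0
    have hθa : θ a ∈ B := hθB a ha
    rw [hB, Submodule.mem_bot] at hθa
    exact ha0 (hθinj a ha hθa)
  have hsurj' : ∀ a ∈ A, ∃ b ∈ B, θ' b = a :=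
    onto_of_embed_of_irreducible' (G := G) θ' hBst hB0 hAirr hθ'A hθ'inj hθ'eq
  exact container_eq_of_iso θ hθeq hsurj θ' hθ'eq hsurj'

end Containers

/-! ### §2 The class block is the intersection with the container -/

section Classes

variable {C : Type uC} [Fintype C] {Yc : C → Type vC} [∀ c, MulAction G (Yc c)] [∀ c, Fintype (Yc c)]
  {Ar : ∀ c, Submodule ℚ (Yc c → ℚ)} {𝒟 : ∀ c, Submodule ℚ ((Yc c → ℚ) →ₗ[ℚ] (Yc c → ℚ))}
  {S : Type uS} [Fintype S] {Yf : S → Type v} [∀ s, MulAction G (Yf s)] [∀ s, Fintype (Yf s)]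
  {JJ : S → C → Type uJ} [∀ s c, Fintype (JJ s c)]

omit [Fintype S] in
/-- **THE CLASS BLOCK IS INTRINSIC: `(⨆_s S(W_s)) ⊓ 𝒞_c = ⨆_s S(p^s_c)`.**  The coefficient space of the whole family
meets the container of the reference `A_c` exactly in the class-`c` block (gen 75 M2: `⨆_s S(W_s) = ⨆_c B_c`,
`B_c ≤ 𝒞_c`, the `𝒞_c` independent). [cite: Serre1977, §2.6] [cite: Lang2002, XVII §2] -/
theorem iSup_span_shadowCoeff_inf_container_eq
    (hRst : ∀ c (k : G) (a : Yc c → ℚ), a ∈ Ar c → (fun y => a (k • y)) ∈ Ar c)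
    (hRirr : ∀ c (W : Submodule ℚ (Yc c → ℚ)), W ≤ Ar c → W ≠ ⊥ →
      (∀ (k : G) (f : Yc c → ℚ), f ∈ W → (fun y => f (k • y)) ∈ W) → W = Ar c)
    (hsep : ∀ c c' (L : (Yc c → ℚ) →ₗ[ℚ] (Yc c' → ℚ)), c ≠ c' → Ar c ≠ ⊥ → (∀ a ∈ Ar c, L a ∈ Ar c') →
      (∀ a ∈ Ar c, L a = 0 → a = 0) →
      (∀ (k : G) (a : Yc c → ℚ), a ∈ Ar c → L (fun y => a (k • y)) = fun y => L a (k • y)) → False)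
    (ι : ∀ s c, JJ s c → ((Yc c → ℚ) →ₗ[ℚ] (Yf s → ℚ)))
    (hιeq : ∀ s c (j : JJ s c) (k : G) (a : Yc c → ℚ), a ∈ Ar c →
      ι s c j (fun y => a (k • y)) = fun y => ι s c j a (k • y))
    (hind : ∀ s c (f : JJ s c → (Yc c → ℚ)), (∀ j, f j ∈ Ar c) → ∑ j, ι s c j (f j) = 0 → ∀ j, f j = 0)
    {b : ∀ s c, JJ s c → (Yc c → ℚ)} (hb : ∀ s c j, b s c j ∈ Ar c) (c : C) :
    (⨆ s, Submodule.span ℚ (Set.range fun y : Yf s => fun g : G => (∑ c, ∑ j, ι s c j (b s c j)) (g • y))) ⊓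
        ⨆ y : Yc c, (Ar c).map (LinearMap.funLeft ℚ ℚ (fun g : G => g • y)) =
      ⨆ s, Submodule.span ℚ (Set.range fun y : Yf s => fun g : G => (∑ j, ι s c j (b s c j)) (g • y)) := by
  have hsplit := iSup_span_shadowCoeff_sum_classes_eq_iSup hRst hRirr hsep ι hιeq hind hb
  refine le_antisymm ?_ (le_inf ?_ (iSup_span_shadowCoeff_le_container c ι hιeq hb))
  · refine le_of_le_iSup_of_iSupIndep (iSupIndep_container_of_classes hRst hRirr hsep)
      (fun c' => iSup_span_shadowCoeff_le_container c' ι hιeq hb) inf_le_right ?_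
    rw [← hsplit]
    exact inf_le_left
  · rw [hsplit]
    exact le_iSup (fun c' => ⨆ s, Submodule.span ℚ
      (Set.range fun y : Yf s => fun g : G => (∑ j, ι s c' j (b s c' j)) (g • y))) c

/-- **THE CLASS MULTIPLICITIES ARE INTRINSIC: `dim((⨆_s S(W_s)) ⊓ 𝒞_c) = r_c·dim A_c`** with
`dim ⨆_{s,j} 𝒟_c·b^s_{c,j} = r_c·δ_c`, `r_c ≤ Σ_s |J_{s,c}|` (every class), and `dim ⨆_s S(W_s) = Σ_c r_c·dim A_c` —
the `𝒟_c`-rank `r_c` of the components is `dim((⨆_s S(W_s)) ∩ 𝒞_c) / dim A_c`, a number that does not mention the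
decomposition (gen 74 S3 per class + §2). [cite: Serre1977, §2.6] [cite: Lang2002, XVII §3] -/
theorem exists_rank_finrank_iSup_span_shadowCoeff_inf_container_eq
    (h𝒟 : ∀ c (L : (Yc c → ℚ) →ₗ[ℚ] (Yc c → ℚ)), L ∈ 𝒟 c ↔ (∀ a ∈ Ar c, L a ∈ Ar c) ∧
      ∀ (k : G) (a : Yc c → ℚ), a ∈ Ar c → L (fun y => a (k • y)) = fun y => L a (k • y))
    (hRst : ∀ c (k : G) (a : Yc c → ℚ), a ∈ Ar c → (fun y => a (k • y)) ∈ Ar c)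
    (hRirr : ∀ c (W : Submodule ℚ (Yc c → ℚ)), W ≤ Ar c → W ≠ ⊥ →
      (∀ (k : G) (f : Yc c → ℚ), f ∈ W → (fun y => f (k • y)) ∈ W) → W = Ar c)
    (hsep : ∀ c c' (L : (Yc c → ℚ) →ₗ[ℚ] (Yc c' → ℚ)), c ≠ c' → Ar c ≠ ⊥ → (∀ a ∈ Ar c, L a ∈ Ar c') →
      (∀ a ∈ Ar c, L a = 0 → a = 0) →
      (∀ (k : G) (a : Yc c → ℚ), a ∈ Ar c → L (fun y => a (k • y)) = fun y => L a (k • y)) → False)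
    (ι : ∀ s c, JJ s c → ((Yc c → ℚ) →ₗ[ℚ] (Yf s → ℚ)))
    (hιeq : ∀ s c (j : JJ s c) (k : G) (a : Yc c → ℚ), a ∈ Ar c →
      ι s c j (fun y => a (k • y)) = fun y => ι s c j a (k • y))
    (hind : ∀ s c (f : JJ s c → (Yc c → ℚ)), (∀ j, f j ∈ Ar c) → ∑ j, ι s c j (f j) = 0 → ∀ j, f j = 0)
    {b : ∀ s c, JJ s c → (Yc c → ℚ)} (hb : ∀ s c j, b s c j ∈ Ar c)
    {a₀ : ∀ c, Yc c → ℚ} (ha₀ : ∀ c, a₀ c ∈ Ar c) (h0 : ∀ c, a₀ c ≠ 0) :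
    ∃ r : C → ℕ, (∀ c, r c ≤ ∑ s, Fintype.card (JJ s c)) ∧
      (∀ c, Module.finrank ℚ ↥(⨆ s, ⨆ j, (𝒟 c).map (LinearMap.applyₗ (b s c j))) =
        r c * Module.finrank ℚ ↥((𝒟 c).map (LinearMap.applyₗ (a₀ c)))) ∧
      (∀ c, Module.finrank ℚ
          ↥((⨆ s, Submodule.span ℚ
              (Set.range fun y : Yf s => fun g : G => (∑ c, ∑ j, ι s c j (b s c j)) (g • y))) ⊓
            ⨆ y : Yc c, (Ar c).map (LinearMap.funLeft ℚ ℚ (fun g : G => g • y))) =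
        r c * Module.finrank ℚ (Ar c)) ∧
      Module.finrank ℚ ↥(⨆ s, Submodule.span ℚ
          (Set.range fun y : Yf s => fun g : G => (∑ c, ∑ j, ι s c j (b s c j)) (g • y))) =
        ∑ c, r c * Module.finrank ℚ (Ar c) := by
  choose r hr hD hS using fun c => exists_rank_finrank_iSup_span_shadowCoeff_eq (Yf := Yf) (h𝒟 c) (hRst c)
    (hRirr c) (fun s => ι s c) (fun s => hιeq s c) (fun s => hind s c) (fun s => hb s c) (ha₀ c) (h0 c)
  refine ⟨r, hr, hD, fun c => ?_, ?_⟩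
  · rw [iSup_span_shadowCoeff_inf_container_eq hRst hRirr hsep ι hιeq hind hb c]
    exact hS c
  · rw [finrank_iSup_span_shadowCoeff_eq_sum_of_classes hRst hRirr hsep ι hιeq hind hb]
    exact Finset.sum_congr rfl fun c _ => hS c

end Classes

/-! ### §3 Type ranks: the class multiplicities of the Hodge character module are intrinsic -/

section Family

variable {I : Type u} {E : I → Type v} [∀ i, MulAction G (E i)] [∀ i, Fintype (E i)] [Fintype I]
  [∀ i, Nonempty (E i)]
  {C : Type uC} [Fintype C] {Yc : C → Type vC} [∀ c, MulAction G (Yc c)] [∀ c, Fintype (Yc c)]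
  {Ar : ∀ c, Submodule ℚ (Yc c → ℚ)} {𝒟 : ∀ c, Submodule ℚ ((Yc c → ℚ) →ₗ[ℚ] (Yc c → ℚ))}
  {JJ : I → C → Type uJ} [∀ i c, Fintype (JJ i c)]

/-- **`dim((⨆_i MC_i) ⊓ 𝒞_c) = r_c·dim A_c` AND `rank Σ = Σ_c r_c·dim A_c + 1`** for a family of CM types whose
type vectors are decomposed over pairwise non-embeddable references (`MC_i = span{g ↦ u_i(g·x)} ≤ ℚ^G`, the character
space of `MT(A_i)`; `⨆_i MC_i` that of `MT(∏_i A_i)`): the multiplicity `r_c` of the class `c` in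
`dim Hg(∏_i A_i) = Σ_c r_c·dim A_c` (gen 75 M5) is the intrinsic number `dim((⨆_i MC_i) ∩ 𝒞_c)/dim A_c`.
[cite: Deligne1982HodgeCycles, I.5 (p. 53)] [cite: Serre1977, §2.6] [cite: Lang2002, XVII §3] -/
theorem exists_rank_finrank_iSup_span_coeff_inf_container_eq [Nonempty I] {ρ : G} {Φ : ∀ i, Set (E i)}
    (h : ∀ i, IsCMTypeWith ρ (Φ i))
    (h𝒟 : ∀ c (L : (Yc c → ℚ) →ₗ[ℚ] (Yc c → ℚ)), L ∈ 𝒟 c ↔ (∀ a ∈ Ar c, L a ∈ Ar c) ∧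
      ∀ (k : G) (a : Yc c → ℚ), a ∈ Ar c → L (fun y => a (k • y)) = fun y => L a (k • y))
    (hRst : ∀ c (k : G) (a : Yc c → ℚ), a ∈ Ar c → (fun y => a (k • y)) ∈ Ar c)
    (hRirr : ∀ c (W : Submodule ℚ (Yc c → ℚ)), W ≤ Ar c → W ≠ ⊥ →
      (∀ (k : G) (f : Yc c → ℚ), f ∈ W → (fun y => f (k • y)) ∈ W) → W = Ar c)
    (hsep : ∀ c c' (L : (Yc c → ℚ) →ₗ[ℚ] (Yc c' → ℚ)), c ≠ c' → Ar c ≠ ⊥ → (∀ a ∈ Ar c, L a ∈ Ar c') →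
      (∀ a ∈ Ar c, L a = 0 → a = 0) →
      (∀ (k : G) (a : Yc c → ℚ), a ∈ Ar c → L (fun y => a (k • y)) = fun y => L a (k • y)) → False)
    (ι : ∀ i c, JJ i c → ((Yc c → ℚ) →ₗ[ℚ] (E i → ℚ)))
    (hιeq : ∀ i c (j : JJ i c) (k : G) (a : Yc c → ℚ), a ∈ Ar c →
      ι i c j (fun y => a (k • y)) = fun y => ι i c j a (k • y))
    (hind : ∀ i c (f : JJ i c → (Yc c → ℚ)), (∀ j, f j ∈ Ar c) → ∑ j, ι i c j (f j) = 0 → ∀ j, f j = 0)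
    {b : ∀ i c, JJ i c → (Yc c → ℚ)} (hb : ∀ i c j, b i c j ∈ Ar c)
    (hu : ∀ i, antiVec (Φ i) (1 : G) = ∑ c, ∑ j, ι i c j (b i c j))
    {a₀ : ∀ c, Yc c → ℚ} (ha₀ : ∀ c, a₀ c ∈ Ar c) (h0 : ∀ c, a₀ c ≠ 0) :
    ∃ r : C → ℕ, (∀ c, r c ≤ ∑ i, Fintype.card (JJ i c)) ∧
      (∀ c, Module.finrank ℚ ↥(⨆ i, ⨆ j, (𝒟 c).map (LinearMap.applyₗ (b i c j))) =
        r c * Module.finrank ℚ ↥((𝒟 c).map (LinearMap.applyₗ (a₀ c)))) ∧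
      (∀ c, Module.finrank ℚ
          ↥((⨆ i, Submodule.span ℚ (Set.range fun x : E i => fun g : G => antiVec (Φ i) g x)) ⊓
            ⨆ y : Yc c, (Ar c).map (LinearMap.funLeft ℚ ℚ (fun g : G => g • y))) =
        r c * Module.finrank ℚ (Ar c)) ∧
      typeRank G (sigmaType Φ) = (∑ c, r c * Module.finrank ℚ (Ar c)) + 1 := by
  obtain ⟨i₀⟩ := ‹Nonempty I›
  haveI : Nonempty (Σ i, E i) := ⟨⟨i₀, Classical.arbitrary (E i₀)⟩⟩
  have hcoeff : (⨆ i, Submodule.span ℚ (Set.range fun x : E i => fun g : G => antiVec (Φ i) g x)) =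
      ⨆ i, Submodule.span ℚ (Set.range fun x : E i => fun g : G => (∑ c, ∑ j, ι i c j (b i c j)) (g • x)) :=
    iSup_congr fun i => span_coeff_eq_span_shadowCoeff_of_eq Φ i (hu i)
  obtain ⟨r, hr, hD, hI, hS⟩ := exists_rank_finrank_iSup_span_shadowCoeff_inf_container_eq (Yf := E) h𝒟 hRst
    hRirr hsep ι hιeq hind hb ha₀ h0
  refine ⟨r, hr, hD, fun c => ?_, ?_⟩
  · rw [hcoeff]
    exact hI c
  · rw [(IsCMTypeWith.sigmaType h).typeRank_eq_finrank_antiSpan_add_one,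
      finrank_antiSpan_sigmaType_eq_finrank_iSup_span_coeff Φ, hcoeff, hS]

end Family

/-! ### §4 With no input but the types -/

section NoInput

variable {I : Type u} {E : I → Type v} [∀ i, MulAction G (E i)] [∀ i, Fintype (E i)] [Fintype I]
  [∀ i, Nonempty (E i)]

/-- **THE INTRINSIC MULTIPLICITY FORMULA WITH NO INPUT BUT THE TYPES**: for every family of CM types there are
pairwise non-embeddable stable irreducible non-zero references `A_c ≤ ℚ^{⊔_i E_i}` (`c ∈ Fin n`) and integers `r_c`
with **`dim((⨆_i MC_i) ⊓ 𝒞_c) = r_c·dim A_c`** for every class and **`rank Σ = Σ_c r_c·dim A_c + 1`** — the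
dimension of the Hodge character module is the sum of the dimensions of its intersections with the containers of the
references (E3 + §3). [cite: Deligne1982HodgeCycles, I.5 (p. 53)] [cite: Serre1977, §2.6] -/
theorem exists_isotypic_finrank_inf_container_eq [Nonempty I] {ρ : G} {Φ : ∀ i, Set (E i)}
    (h : ∀ i, IsCMTypeWith ρ (Φ i)) :
    ∃ (n : ℕ) (Ar : Fin n → Submodule ℚ ((Σ i, E i) → ℚ)) (r : Fin n → ℕ),
      (∀ (c : Fin n) (k : G) (a : (Σ i, E i) → ℚ), a ∈ Ar c → (fun x => a (k • x)) ∈ Ar c) ∧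
      (∀ (c : Fin n) (W : Submodule ℚ ((Σ i, E i) → ℚ)), W ≤ Ar c → W ≠ ⊥ →
        (∀ (k : G) (f : (Σ i, E i) → ℚ), f ∈ W → (fun x => f (k • x)) ∈ W) → W = Ar c) ∧
      (∀ c : Fin n, Ar c ≠ ⊥) ∧
      (∀ (c c' : Fin n) (L : ((Σ i, E i) → ℚ) →ₗ[ℚ] ((Σ i, E i) → ℚ)), c ≠ c' → Ar c ≠ ⊥ →
        (∀ a ∈ Ar c, L a ∈ Ar c') → (∀ a ∈ Ar c, L a = 0 → a = 0) →
        (∀ (k : G) (a : (Σ i, E i) → ℚ), a ∈ Ar c → L (fun x => a (k • x)) = fun x => L a (k • x)) →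
        False) ∧
      (∀ c, Module.finrank ℚ
          ↥((⨆ i, Submodule.span ℚ (Set.range fun x : E i => fun g : G => antiVec (Φ i) g x)) ⊓
            ⨆ y : (Σ i, E i), (Ar c).map (LinearMap.funLeft ℚ ℚ (fun g : G => g • y))) =
        r c * Module.finrank ℚ (Ar c)) ∧
      typeRank G (sigmaType Φ) = (∑ c, r c * Module.finrank ℚ (Ar c)) + 1 := by
  obtain ⟨n, Ar, 𝒟, m, ι, b, a₀, h𝒟, hRst, hRirr, hR0, hsep, hιeq, hind, hb, hu, ha₀, h0⟩ :=
    exists_isotypic_decomposition_antiVec (G := G) Φ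
  obtain ⟨r, -, -, hI, hS⟩ := exists_rank_finrank_iSup_span_coeff_inf_container_eq
    (Yc := fun _ : Fin n => Σ i, E i) (JJ := fun i c => Fin (m i c)) h h𝒟 hRst hRirr hsep ι hιeq hind hb hu ha₀ h0
  exact ⟨n, Ar, r, hRst, hRirr, hR0, hsep, hI, hS⟩

end NoInput

end Summit.HodgeConjecture.CorCM.IrrOdd

/-! ### §5 Products of CM abelian varieties -/

namespace Summit.HodgeConjecture.CorCM

open CategoryTheory CategoryTheory.Limits NumberField Module IntermediateField
open Literature.NumberTheory.ComplexMultiplication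
open Literature.AlgebraicGeometry.Motives (AbelianVariety CMType)
open Literature.AlgebraicGeometry.Motives.AbelianVariety
open Literature.AlgebraicGeometry.HodgeTheory
open Literature.AlgebraicGeometry.ComplexMultiplication (IsCMTypeRealisation)
open Literature.AlgebraicGeometry.Pohlmann1968

variable {I : Type} [Fintype I] {K : I → Type} [∀ i, Field (K i)] [∀ i, NumberField (K i)] [∀ i, IsCMField (K i)]

/-- **THE CLASS MULTIPLICITIES OF `X^*(MT(∏_i A_i))` ARE INTRINSIC (CM fields)**: there are pairwise non-embeddable
`Aut(ℂ)`-stable irreducible non-zero references `A_c ≤ ℚ^{⊔_i Hom(K_i, ℂ)}` and integers `r_c` with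
**`dim((⨆_i MC_i) ⊓ 𝒞_c) = r_c·dim A_c`** and **`cmFamilyRank Φ = Σ_c r_c·dim A_c + 1`** (`dim Hg(∏_i A_i) =
Σ_c r_c·dim A_c`; `MC_i ≤ ℚ^{Aut(ℂ)}` the character space of `MT(A_i)`, `𝒞_c = Σ_y Θ_y(A_c)` the container of the
class). [cite: Deligne1982HodgeCycles, I.5 (p. 53)] [cite: Serre1977, §2.6] -/
theorem exists_isotypic_cm_finrank_inf_container_eq [Nonempty I] (Φ : ∀ i, CMType (K i)) :
    ∃ (n : ℕ) (Ar : Fin n → Submodule ℚ ((Σ i, (K i →+* ℂ)) → ℚ)) (r : Fin n → ℕ),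
      (∀ (c : Fin n) (k : ℂ ≃+* ℂ) (a : (Σ i, (K i →+* ℂ)) → ℚ), a ∈ Ar c → (fun x => a (k • x)) ∈ Ar c) ∧
      (∀ (c : Fin n) (W : Submodule ℚ ((Σ i, (K i →+* ℂ)) → ℚ)), W ≤ Ar c → W ≠ ⊥ →
        (∀ (k : ℂ ≃+* ℂ) (f : (Σ i, (K i →+* ℂ)) → ℚ), f ∈ W → (fun x => f (k • x)) ∈ W) → W = Ar c) ∧
      (∀ c : Fin n, Ar c ≠ ⊥) ∧
      (∀ (c c' : Fin n) (L : ((Σ i, (K i →+* ℂ)) → ℚ) →ₗ[ℚ] ((Σ i, (K i →+* ℂ)) → ℚ)), c ≠ c' → Ar c ≠ ⊥ →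
        (∀ a ∈ Ar c, L a ∈ Ar c') → (∀ a ∈ Ar c, L a = 0 → a = 0) →
        (∀ (k : ℂ ≃+* ℂ) (a : (Σ i, (K i →+* ℂ)) → ℚ), a ∈ Ar c →
          L (fun x => a (k • x)) = fun x => L a (k • x)) → False) ∧
      (∀ c, Module.finrank ℚ
          ↥((⨆ i, Submodule.span ℚ
              (Set.range fun x : (K i →+* ℂ) => fun g : (ℂ ≃+* ℂ) => antiVec (Φ i).1 g x)) ⊓
            ⨆ y : (Σ i, (K i →+* ℂ)), (Ar c).map (LinearMap.funLeft ℚ ℚ (fun g : (ℂ ≃+* ℂ) => g • y))) =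
        r c * Module.finrank ℚ (Ar c)) ∧
      CMAlgebra.cmFamilyRank Φ = (∑ c, r c * Module.finrank ℚ (Ar c)) + 1 := by
  haveI : ∀ i, Nonempty (K i →+* ℂ) := fun i => inferInstance
  exact IrrOdd.exists_isotypic_finrank_inf_container_eq (G := ℂ ≃+* ℂ) (E := fun i => K i →+* ℂ)
    (Φ := fun i => (Φ i).1) fun i => isCMTypeWith_conj (Φ i)

end Summit.HodgeConjecture.CorCM

end
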